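import Summits.BirchSwinnertonDyer.BirchSwinnertonDyer.Theorems.PrintCFramBottomClassIndexLawFiveLeKrizLiBindersTwist
import HarnessLib

/-!
# Crux `PrintCFram.BottomClassIndexLawFiveLe` (stmt-BirchSwinnertonDyer-20372), line `eisenstein-resource-bdp-line`:
# the KRIZ–LI BINDERS CLASS-LEVEL, part M — the PER-MEMBER interface with an EXPLICIT character: from a coprime twisting
# presentation `W ∼ W₁ ≅ E^{(e)}` and ANY `ℚ_p`-valued character `χ` with the Kronecker values of `e`, the binders of
# `ψ = χ↑·(ω^k)↑` (primitive, `hss`, (1), (3)) — the input shape of a Bernoulli-(4) certificate seat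
# (cell `bsd-print-cfram`, width seat `bsd-line-cfram-p1-w3` g2; THEOREMS ONLY, `--supports` 20372; BSD is not proved by any of this)

HONEST FRAMING. Nothing here is a statement about BSD. Part W (`…KrizLiBinders.lean`) proves that the character block of the
Kriz–Li datum EXISTS class-wide; but the remaining hypothesis (4) `p ∤ B_{1,ψ₀⁻¹ε_K}·B_{1,ψ₀ω⁻¹}` is certified (as in cell
`bsd-cm`'s Route U: `RouteUBernoulliCertificate`, `RouteUBernoulliD11`) for an EXPLICIT `ψ`. This file is the explicit-`χ`
form of part T's twist layer fused with its engine, generic in the odd prime `p`, the base curve `E` (good away from `p`,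
trace form `a_ℓ(E) ≡ ℓ^k + ℓ^{p−k}`), the exponent `2 ≤ k ≤ p − 2` and the member:

* `krizLiBinders_of_coprime_twist_odd` — `e ≡ 1 (mod 4)` squarefree, `p ∤ e`, `χ` mod `|e|` with `χ(a) = J(a | |e|)`:
  `ψ := χ↑·(ω^k)↑` (level `p·|e|`) is primitive and satisfies `hss`, (1), (3) for `W`;
* `krizLiBinders_of_coprime_twist_even` — `e ≡ 2, 3 (mod 4)` squarefree, `p ∤ e`, `χ` mod `4|e|` with
  `χ(a) = [a odd]·J(e | a)`: the same for `ψ := χ↑·(ω^k)↑` (level `p·4|e|`).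

Parity is separate (`psi_odd_of`, part Ψ: `ψ` odd iff `χ(−1)·(−1)^k = −1`, `χ(−1) = sign e`). With `E = cm11, k = 3` and
w2 g2's `lFunction_cm11_mod` / `hasGoodReductionAtPrime_cm11` this is Route U^{(11)}'s `hss`+(1)+(3) layer for every member
`A(11)^{(e)}` at once (similarly `cm7/2`, `cm19/5`, `cm43/11`, `cm67/17`, `cm163/41`, or the complementary exponents).
beyond-print theorem: NO. References: [KrizLi2019] Thm. 1.20, Rem. 1.21, §2; [SilvermanAEC2009] X.2 Ex. 10.16, X.5 Prop. 5.4;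
[Cox2013] §1.C Lemma 1.14.
-/

noncomputable section

-- summit-side namespace `Summit.BirchSwinnertonDyer.BirchSwinnertonDyer.…` (single-conjunct summit, D-0017 layout)
set_option linter.dupNamespace false

open scoped Classical NumberTheorySymbols
open NumberField IsDedekindDomain IsDedekindDomain.HeightOneSpectrum WeierstrassCurve DirichletCharacter
open Literature.NumberTheory.EllipticCurves Literature.NumberTheory.EllipticCurves.KrizLi2019
open Literature.NumberTheory.EllipticCurves.Rank1Residual Literature.NumberTheory.QuadraticFields
open Summit.BirchSwinnertonDyer.Rank1Residual Summit.BirchSwinnertonDyer.Rank1Residual.X12.O11.RouteU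

namespace Summit.BirchSwinnertonDyer.BirchSwinnertonDyer.Theorems.PrintCFram.KrizLiBinders

variable {p : ℕ} [hp : Fact p.Prime]

/-- **Per-member binders, ODD twisting discriminant.** `p` odd; `E/ℚ` elliptic, good away from `p`, with trace form
`a_ℓ(E) ≡ ℓ^k + ℓ^{p−k} (mod p)` (`2 ≤ k ≤ p − 2`); `W ∼ W₁` `ℚ`-isogenous, `C • W₁ = E^{(e)}` with `e ≡ 1 (mod 4)` squarefree,
`p ∤ e`; `χ` a `ℚ_p`-valued character mod `|e|` with `χ(a) = J(a | |e|)`; `ω` Teichmüller. Then `ψ := χ↑·(ω^k)↑` (level `p·|e|`)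
is PRIMITIVE and satisfies Kriz–Li's `hss`, (1), (3) for `W`, verbatim.
[cite: KrizLi2019, Thm. 1.20 (pp. 7–8), Rem. 1.21, §2] [cite: SilvermanAEC2009, X.2 and Exercise 10.16] -/
theorem krizLiBinders_of_coprime_twist_odd (hp2 : p ≠ 2) (E : WeierstrassCurve ℚ) [E.IsElliptic] {k : ℕ}
    (hk2 : 2 ≤ k) (hkp : k ≤ p - 2)
    (hgood : ∀ (q : ℕ) [Fact q.Prime], q ≠ p → E.HasGoodReductionAtPrime q)
    (hbase : ∀ (ℓ : ℕ) [Fact ℓ.Prime], ℓ ≠ p → (E.LFunction ℓ : ZMod p) = (ℓ : ZMod p) ^ k + (ℓ : ZMod p) ^ (p - k))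
    (W W₁ : WeierstrassCurve ℚ) [W.IsElliptic] [W₁.IsElliptic] (hiso : IsIsogenous W W₁)
    {e : ℤ} (he4 : e % 4 = 1) (hsq : Squarefree e) (hpe : ¬ (p : ℤ) ∣ e)
    (hW₁ : ∃ C : VariableChange ℚ, C • W₁ = E.quadraticTwist (e : ℚ)) [NeZero e.natAbs]
    (χ : DirichletCharacter ℚ_[p] e.natAbs) (hχ : ∀ a : ℕ, χ (a : ZMod e.natAbs) = (J((a : ℤ) | e.natAbs) : ℚ_[p]))
    (ω : DirichletCharacter ℚ_[p] p) (hω : IsTeichmullerCharacter ω) :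
    (changeLevel (dvd_mul_left e.natAbs p) χ * changeLevel (dvd_mul_right p e.natAbs) (ω ^ k) :
        DirichletCharacter ℚ_[p] (p * e.natAbs)).IsPrimitive ∧
    (∀ ℓ : ℕ, ℓ.Prime → ¬ (ℓ ∣ p * W.conductorNorm ℤ) →
      ‖((W.LFunction ℓ : ℤ) : ℚ_[p]) -
        ((changeLevel (dvd_mul_left e.natAbs p) χ * changeLevel (dvd_mul_right p e.natAbs) (ω ^ k) :
            DirichletCharacter ℚ_[p] (p * e.natAbs)) (ℓ : ZMod (p * e.natAbs)) +
          (changeLevel (dvd_mul_left e.natAbs p) χ * changeLevel (dvd_mul_right p e.natAbs) (ω ^ k) :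
            DirichletCharacter ℚ_[p] (p * e.natAbs))⁻¹ (ℓ : ZMod (p * e.natAbs)) * ω (ℓ : ZMod p))‖ < 1) ∧
    ((changeLevel (dvd_mul_left e.natAbs p) χ * changeLevel (dvd_mul_right p e.natAbs) (ω ^ k) :
        DirichletCharacter ℚ_[p] (p * e.natAbs)) (p : ZMod (p * e.natAbs)) ≠ 1 ∧
      primVal (invMulOmega (changeLevel (dvd_mul_left e.natAbs p) χ *
        changeLevel (dvd_mul_right p e.natAbs) (ω ^ k)) ω) p ≠ 1) ∧
    (∀ ℓ : ℕ, (hℓ : ℓ.Prime) → ℓ ≠ p →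
      (haveI := Fact.mk hℓ; ¬ W.HasGoodReductionAtPrime ℓ ∧ ¬ W.HasMultiplicativeReductionAtPrime ℓ) →
      (changeLevel (dvd_mul_left e.natAbs p) χ * changeLevel (dvd_mul_right p e.natAbs) (ω ^ k) :
          DirichletCharacter ℚ_[p] (p * e.natAbs)) (ℓ : ZMod (p * e.natAbs)) ≠ 1 ∧
        primVal (invMulOmega (changeLevel (dvd_mul_left e.natAbs p) χ *
          changeLevel (dvd_mul_right p e.natAbs) (ω ^ k)) ω) ℓ ≠ 1) := by
  have hpp : p.Prime := hp.out
  obtain ⟨C, hC⟩ := hW₁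
  have hLW : W.LFunction = W₁.LFunction := hiso.LFunction_eq
  have hpe' : ¬ p ∣ e.natAbs := fun h => hpe (Int.natCast_dvd.mpr h)
  have hcopE : e.natAbs.Coprime p := ((Nat.Prime.coprime_iff_not_dvd hpp).mpr hpe').symm
  have hodd : Odd e.natAbs := by rw [Int.natAbs_odd, Int.odd_iff]; omega
  have hsqn : Squarefree e.natAbs := Int.squarefree_natAbs.mpr hsq
  refine krizLiBinders_of_data hp2 W χ (isPrimitive_of_forall_eq_jacobiSym hχ hodd hsqn)
    (isQuadratic_of_forall_eq_jacobiSym hχ) hcopE (fun a => J((a : ℤ) | e.natAbs)) (fun ℓ _ _ => hχ ℓ) hk2 hkp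
    (fun ℓ hℓ hne => ?_) (fun ℓ hℓ hne hℓm => ?_) ω hω
  · haveI := Fact.mk hℓ
    rw [hLW]
    exact EisensteinTraceForm.lFunction_twist_mod_of_traceForm E p k (p - k) hgood hbase W₁ he4 hsq hpe ⟨C, hC⟩ ℓ hne
  · haveI := Fact.mk hℓ
    obtain ⟨v, rfl⟩ : ∃ v : HeightOneSpectrum (𝓞 ℚ), (Rat.HeightOneSpectrum.primesEquiv v : ℕ) = ℓ :=
      ⟨Rat.HeightOneSpectrum.primesEquiv.symm ⟨ℓ, hℓ⟩, by rw [Equiv.apply_symm_apply]⟩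
    have htw : (E.quadraticTwist (e : ℚ)).HasGoodReductionAt v :=
      hasGoodReductionAt_quadraticTwist_of_emod_four_any E v he4 (fun h => hℓm (Int.natCast_dvd.mp h))
        (hasGoodReductionAt_of_forall_prime_ne E hgood v hne)
    have h1 : (C • W₁).HasGoodReductionAt v := by rw [hC]; exact htw
    have h2 : W₁.HasGoodReductionAt v := (hasGoodReductionAt_smul_iff_holds v W₁ C).mp h1
    exact (hiso.hasGoodReductionAtPrime_iff _).mpr
      ((hasGoodReductionAtPrime_iff_hasGoodReductionAt_ringOfIntegers v W₁).mpr h2)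

/-- **Per-member binders, EVEN twisting discriminant.** As `krizLiBinders_of_coprime_twist_odd`, with `e ≡ 2, 3 (mod 4)`
squarefree, `p ∤ e`, and `χ` a `ℚ_p`-valued character mod `4|e|` with `χ(a) = [a odd]·J(e | a)`: `ψ := χ↑·(ω^k)↑` (level
`p·4|e|`) is PRIMITIVE and satisfies `hss`, (1), (3) for `W`, verbatim.
[cite: KrizLi2019, Thm. 1.20 (pp. 7–8), Rem. 1.21, §2] [cite: SilvermanAEC2009, X.2 and Exercise 10.16] [cite: Cox2013, §1.C Lemma 1.14] -/
theorem krizLiBinders_of_coprime_twist_even (hp2 : p ≠ 2) (E : WeierstrassCurve ℚ) [E.IsElliptic] {k : ℕ}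
    (hk2 : 2 ≤ k) (hkp : k ≤ p - 2)
    (hgood : ∀ (q : ℕ) [Fact q.Prime], q ≠ p → E.HasGoodReductionAtPrime q)
    (hbase : ∀ (ℓ : ℕ) [Fact ℓ.Prime], ℓ ≠ p → (E.LFunction ℓ : ZMod p) = (ℓ : ZMod p) ^ k + (ℓ : ZMod p) ^ (p - k))
    (W W₁ : WeierstrassCurve ℚ) [W.IsElliptic] [W₁.IsElliptic] (hiso : IsIsogenous W W₁)
    {e : ℤ} (he4 : e % 4 = 2 ∨ e % 4 = 3) (hsq : Squarefree e) (hpe : ¬ (p : ℤ) ∣ e)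
    (hW₁ : ∃ C : VariableChange ℚ, C • W₁ = E.quadraticTwist (e : ℚ)) [NeZero (4 * e.natAbs)]
    (χ : DirichletCharacter ℚ_[p] (4 * e.natAbs))
    (hχ : ∀ a : ℕ, χ (a : ZMod (4 * e.natAbs)) = ((if Even a then (0 : ℤ) else J(e | a) : ℤ) : ℚ_[p]))
    (ω : DirichletCharacter ℚ_[p] p) (hω : IsTeichmullerCharacter ω) :
    (changeLevel (dvd_mul_left (4 * e.natAbs) p) χ * changeLevel (dvd_mul_right p (4 * e.natAbs)) (ω ^ k) :
        DirichletCharacter ℚ_[p] (p * (4 * e.natAbs))).IsPrimitive ∧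
    (∀ ℓ : ℕ, ℓ.Prime → ¬ (ℓ ∣ p * W.conductorNorm ℤ) →
      ‖((W.LFunction ℓ : ℤ) : ℚ_[p]) -
        ((changeLevel (dvd_mul_left (4 * e.natAbs) p) χ * changeLevel (dvd_mul_right p (4 * e.natAbs)) (ω ^ k) :
            DirichletCharacter ℚ_[p] (p * (4 * e.natAbs))) (ℓ : ZMod (p * (4 * e.natAbs))) +
          (changeLevel (dvd_mul_left (4 * e.natAbs) p) χ * changeLevel (dvd_mul_right p (4 * e.natAbs)) (ω ^ k) :
            DirichletCharacter ℚ_[p] (p * (4 * e.natAbs)))⁻¹ (ℓ : ZMod (p * (4 * e.natAbs))) * ω (ℓ : ZMod p))‖ < 1) ∧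
    ((changeLevel (dvd_mul_left (4 * e.natAbs) p) χ * changeLevel (dvd_mul_right p (4 * e.natAbs)) (ω ^ k) :
        DirichletCharacter ℚ_[p] (p * (4 * e.natAbs))) (p : ZMod (p * (4 * e.natAbs))) ≠ 1 ∧
      primVal (invMulOmega (changeLevel (dvd_mul_left (4 * e.natAbs) p) χ *
        changeLevel (dvd_mul_right p (4 * e.natAbs)) (ω ^ k)) ω) p ≠ 1) ∧
    (∀ ℓ : ℕ, (hℓ : ℓ.Prime) → ℓ ≠ p →
      (haveI := Fact.mk hℓ; ¬ W.HasGoodReductionAtPrime ℓ ∧ ¬ W.HasMultiplicativeReductionAtPrime ℓ) →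
      (changeLevel (dvd_mul_left (4 * e.natAbs) p) χ * changeLevel (dvd_mul_right p (4 * e.natAbs)) (ω ^ k) :
          DirichletCharacter ℚ_[p] (p * (4 * e.natAbs))) (ℓ : ZMod (p * (4 * e.natAbs))) ≠ 1 ∧
        primVal (invMulOmega (changeLevel (dvd_mul_left (4 * e.natAbs) p) χ *
          changeLevel (dvd_mul_right p (4 * e.natAbs)) (ω ^ k)) ω) ℓ ≠ 1) := by
  have hpp : p.Prime := hp.out
  have he0 : e ≠ 0 := hsq.ne_zero
  have heQ : (e : ℚ) ≠ 0 := by exact_mod_cast he0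
  haveI := E.isElliptic_quadraticTwist heQ
  obtain ⟨C, hC⟩ := hW₁
  have hLW : W.LFunction = W₁.LFunction := hiso.LFunction_eq
  have hpe' : ¬ p ∣ e.natAbs := fun h => hpe (Int.natCast_dvd.mpr h)
  have hcopE : e.natAbs.Coprime p := ((Nat.Prime.coprime_iff_not_dvd hpp).mpr hpe').symm
  have hp4 : ¬ p ∣ 4 := fun h => hp2 ((Nat.prime_dvd_prime_iff_eq hpp Nat.prime_two).mp
    (hpp.dvd_of_dvd_pow (show p ∣ 2 ^ 2 by simpa using h)))
  have hcop4 : (4 : ℕ).Coprime p := ((Nat.Prime.coprime_iff_not_dvd hpp).mpr hp4).symm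
  refine krizLiBinders_of_data hp2 W χ (isPrimitive_of_forall_eq_kroneckerFour' rfl he4 hsq hχ)
    (isQuadratic_of_forall_eq_kroneckerFour hχ) (Nat.Coprime.mul_left hcop4 hcopE)
    (fun a => if Even a then (0 : ℤ) else J(e | a)) (fun ℓ _ _ => hχ ℓ) hk2 hkp
    (fun ℓ hℓ hne => ?_) (fun ℓ hℓ hne hℓm => ?_) ω hω
  · -- trace form via a quadratic field of discriminant `4e`
    haveI := Fact.mk hℓ
    obtain ⟨M, _, _, hM2, hdM⟩ := Quadratic.exists_numberField_discr_eq (D := 4 * e)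
      (Or.inr ⟨dvd_mul_right 4 e, by rw [Int.mul_ediv_cancel_left _ (by norm_num)]; exact he4,
        by rw [Int.mul_ediv_cancel_left _ (by norm_num)]; exact hsq⟩)
    have h4 : 4 ∣ NumberField.discr M := by rw [hdM]; exact dvd_mul_right 4 e
    have hdiv : NumberField.discr M / 4 = e := by rw [hdM, Int.mul_ediv_cancel_left _ (by norm_num)]
    have hgoodv : ∀ v : HeightOneSpectrum (𝓞 ℚ),
        ((Rat.HeightOneSpectrum.primesEquiv v : ℕ) : ℤ) ∣ NumberField.discr M → E.HasGoodReductionAt v := by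
      intro v hvD
      refine hasGoodReductionAt_of_forall_prime_ne E hgood v fun hvp => hpe ?_
      rw [hdM, hvp] at hvD
      exact (Int.Prime.dvd_mul' hpp hvD).resolve_left (fun h => hp4 (by exact_mod_cast h))
    obtain ⟨C₂, hC₂⟩ := E.exists_variableChange_quadraticTwist_mul_sq (e : ℚ) 2 two_ne_zero
    have hC₂' : E.quadraticTwist ((4 : ℚ) * e) = C₂ • E.quadraticTwist (e : ℚ) := by
      rw [hC₂]; congr 1; ring
    have h1 : (E.quadraticTwist (NumberField.discr M : ℚ)).LFunction = W.LFunction := by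
      rw [hdM]
      push_cast
      rw [hC₂', LFunction_smul, ← hC, LFunction_smul, hLW]
    rw [← h1, E.LFunction_quadraticTwist_apply_of_four_dvd_discr M hM2 h4 hgoodv ℓ, hdiv]
    push_cast
    rw [hbase ℓ hne]
  · -- good reduction of `W` at `ℓ ∤ 4|e|`, `ℓ ≠ p`
    haveI := Fact.mk hℓ
    have hℓ2 : ℓ ≠ 2 := by rintro rfl; exact hℓm (dvd_mul_of_dvd_left (by norm_num) _)
    have hℓe : ¬ (ℓ : ℤ) ∣ e := fun h => hℓm (dvd_mul_of_dvd_right (Int.natCast_dvd.mp h) 4)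
    obtain ⟨v, rfl⟩ : ∃ v : HeightOneSpectrum (𝓞 ℚ), (Rat.HeightOneSpectrum.primesEquiv v : ℕ) = ℓ :=
      ⟨Rat.HeightOneSpectrum.primesEquiv.symm ⟨ℓ, hℓ⟩, by rw [Equiv.apply_symm_apply]⟩
    have htw : (E.quadraticTwist (e : ℚ)).HasGoodReductionAt v :=
      hasGoodReductionAt_quadraticTwist_of_odd_any E v hℓ2 hℓe (hasGoodReductionAt_of_forall_prime_ne E hgood v hne)
    have h1 : (C • W₁).HasGoodReductionAt v := by rw [hC]; exact htw
    have h2 : W₁.HasGoodReductionAt v := (hasGoodReductionAt_smul_iff_holds v W₁ C).mp h1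
    exact (hiso.hasGoodReductionAtPrime_iff _).mpr
      ((hasGoodReductionAtPrime_iff_hasGoodReductionAt_ringOfIntegers v W₁).mpr h2)

end Summit.BirchSwinnertonDyer.BirchSwinnertonDyer.Theorems.PrintCFram.KrizLiBinders

end
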